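import Summits.ResolutionOfSingularities.ResolutionOfSingularities.Theorems.PAlterationPicoverLocalModelLocalChartsPointData
import HarnessLib

/-!
# Crux `Picover` (stmt-ResolutionOfSingularities-0554), line `giraud-separated-base` — endgame,
# local charts: the Giraud normal form at a point of the chart, from a POINTWISE hypothesis

Variant of `PicoverLocalModel.LocalCharts.pointData_giraudNormalFormAt` (crux 0557) in which the
normal form at the point `w'` is supplied for the germ of a SECTION `a ∈ Γ(W, U)` of the affine
chart `U` (with its own enumeration of the boundary components through `w'` and its own
generators of their stalk ideals), instead of through a global `π : W → Spec R`, `a ∈ R` and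
`InGiraudNormalForm p W π a E`. This is the form in which the separated line of crux 0554
(`stub_localChartsSep`, uniform-sections format) meets the pointwise algebra of crux 0557: the
conclusion — Giraud normal form for the germs of the spread equations `xs_j` not invertible at
`w'`, in any injective enumeration `σ` — is the hypothesis shape of
`localChart_pointwise_orthant` / `localChart_pointwise_kummer`.

Proof: identical to `giraudNormalFormAt_of_spread` (match the two enumerations through `w'`,
compare generators of the same stalk ideals up to units, `GiraudNormalFormAt.reindex`).
-/

noncomputable section

-- single-problem summit: the doubled namespace component `ResolutionOfSingularities` is the tree layout
set_option linter.dupNamespace false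

open CategoryTheory AlgebraicGeometry TopologicalSpace IsLocalRing
open Literature.AlgebraicGeometry.Resolution
open Summit.ResolutionOfSingularities.ResolutionOfSingularities.Theorems.PicoverLocalModel.LocalCharts

namespace Summit.ResolutionOfSingularities.ResolutionOfSingularities.Theorems.Picover.PointDataPointwise

/-- **The Giraud normal form at a point of the chart, for the spread equations, from a pointwise
normal form of a section.** On an affine open `U` of `W` with spread boundary equations
`xs_j` (`(D_j)|_U = (xs_j)`, the other members of `E` trivial on `U`), if the germ at `w' ∈ U`
of a section `a ∈ Γ(W, U)` is in Giraud normal form along `E` (for SOME enumeration of the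
components through `w'` and SOME generators of their stalk ideals), then it is in Giraud
normal form for the germs of the `xs_j` not invertible at `w'`, in any injective enumeration
`σ` of them. [cite: Giraud1983, Prop. 1.5] -/
theorem pointData_giraudNormalFormAt_of_pointwise : ∀ {W : Scheme.{0}} [IsIntegral W] {E : List W.IdealSheafData} {U : W.affineOpens} {r : ℕ} {D : Fin r → W.IdealSheafData}, (∀ j, D j ∈ E) → Function.Injective D → ∀ {xs : Fin r → Γ(W, (U : W.Opens))}, (∀ j, (D j).ideal U = Ideal.span {xs j}) → (∀ D' ∈ E, (∀ j, D j ≠ D') → D'.ideal U = ⊤) → ∀ {w' : W} (hw' : w' ∈ (U : W.Opens)) {p : ℕ} (a : Γ(W, (U : W.Opens))), (∃ (r' : ℕ) (D' : Fin r' → {D : W.IdealSheafData // D ∈ E ∧ w' ∈ D.support}) (x' : Fin r' → W.presheaf.stalk w'), Function.Bijective D' ∧ (∀ i, stalkIdeal (D' i).1 w' = Ideal.span {x' i}) ∧ GiraudNormalFormAt p x' (W.presheaf.germ (U : W.Opens) w' hw' a)) → ∀ {s : ℕ} (σ : Fin s → Fin r), Function.Injective σ → (∀ j, ¬ IsUnit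 (W.presheaf.germ (U : W.Opens) w' hw' (xs j)) ↔ ∃ i, σ i = j) → GiraudNormalFormAt p (fun i => W.presheaf.germ (U : W.Opens) w' hw' (xs (σ i))) (W.presheaf.germ (U : W.Opens) w' hw' a) := by
  intro W _ E U r D hDE hDinj xs hB1 hB2 w' hw' p a hGw' s σ hσ hJ
  classical
  obtain ⟨r', D', x', hbij, hgen, hNF⟩ := hGw'
  -- match the two enumerations of the components through `w'`
  have key : ∀ i', ∃ i, D (σ i) = (D' i').1 := fun i' => by
    obtain ⟨j, hj, hju⟩ := (mem_support_iff_of_spread hB1 hB2 hw' (D' i').2.1).mp (D' i').2.2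
    obtain ⟨i, rfl⟩ := (hJ j).mp hju
    exact ⟨i, hj⟩
  choose τ hτ using key
  have hτinj : Function.Injective τ := fun i₁ i₂ h => by
    have : (D' i₁).1 = (D' i₂).1 := by rw [← hτ i₁, ← hτ i₂, h]
    exact hbij.1 (Subtype.ext this)
  have hτsurj : Function.Surjective τ := fun i => by
    have hsupp : w' ∈ (D (σ i)).support :=
      (mem_support_iff_of_spread' hB1 hw' _).mpr ((hJ _).mpr ⟨i, rfl⟩)
    obtain ⟨i', hi'⟩ := hbij.2 ⟨D (σ i), hDE _, hsupp⟩
    refine ⟨i', hσ (hDinj ?_)⟩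
    rw [hτ i', hi']
  let πe : Fin r' ≃ Fin s := Equiv.ofBijective τ ⟨hτinj, hτsurj⟩
  -- the two generators of each stalk ideal differ by a unit
  have hassoc : ∀ i', ∃ ε : W.presheaf.stalk w', IsUnit ε ∧
      x' i' = ε * W.presheaf.germ (U : W.Opens) w' hw' (xs (σ (πe i'))) := by
    intro i'
    have h1 : Ideal.span {x' i'} =
        Ideal.span {W.presheaf.germ (U : W.Opens) w' hw' (xs (σ (τ i')))} := by
      rw [← hgen i', ← stalkIdeal_eq_span_germ_of_spread hB1 hw' (σ (τ i')), hτ i']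
    obtain ⟨u, hu⟩ := Ideal.span_singleton_eq_span_singleton.mp h1
    refine ⟨↑u⁻¹, Units.isUnit _, ?_⟩
    change x' i' = ↑u⁻¹ * W.presheaf.germ (U : W.Opens) w' hw' (xs (σ (τ i')))
    rw [← hu, mul_comm (x' i') ↑u, ← mul_assoc, Units.inv_mul, one_mul]
  choose ε hε hxε using hassoc
  exact hNF.reindex (y := fun k => W.presheaf.germ (U : W.Opens) w' hw' (xs (σ k))) πe ε hε hxε

end Summit.ResolutionOfSingularities.ResolutionOfSingularities.Theorems.Picover.PointDataPointwise

end
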